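import Summits.CriticalPhenomena.PercolationContinuityZ3.Theorems.PercNearOneGluingNoHeavyLowerTailMajorityGluingTypeBridgeShape
import Summits.CriticalPhenomena.PercolationContinuityZ3.Theorems.PercNearOneGluingNoHeavyLowerTailMajorityGluingTypeTableScaledDefs
import HarnessLib

/-!
# The TYPE BRIDGE, part IV: the 49 linear rows as BUDGET-ROW SPECIFICATIONS at the shape level (lane prim-rate, constants-miner 1, gen 31; CANDIDATES §GEN-17 R135/R147, §GEN-31)

Support file for the closed crux `NoHeavyLowerTail` (stmt-CriticalPhenomena-4575), majority-gluing line.  Every linear row functional of the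
abstract `(4,3)` programme (`linFree`, 22 rows; `linOrd`, 27 rows) has the shape `(cut_t − cut_s)·1[COND]` where `COND` is either trivial
(`bud`, `od`), or «`t ∉ B_s` and a DOWN-closed condition on which of the two other relays lie in the block `B_s` of the larger-marginal relay `s`»,
or «`s ∉ B_t` and an UP-closed condition on the block `B_t` of the smaller-marginal relay `t`» — exactly the hypotheses of the percolation
budget inequalities `Budget.budget_row` / `Budget.budget_row_up`.  This file records that structure as DATA (`RowSpec`: `s, t, k, l`, flags
`plain`/`up`, the Boolean test `Q`) in two tables `linFreeSpec`, `linOrdSpec`, checks the side conditions (`{s,t,k,l} = {1,2,3,4}`, `Q` antitone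
resp. monotone: `linFreeSpec_ok`, `linOrdSpec_ok`) and proves BY ONE KERNEL EVALUATION over the `2¹⁰` shapes that each row functional evaluated at
the canonical type of a valid shape equals its specification's value (`linFree_eval`, `linOrd_eval`).  Part V turns each specification into a
percolation inequality.  Definitions + decidable facts; no sorries. [cite: VandenbergHaggstromKahn2005, Thm. 1.3 (p. 6)]
-/

namespace Summit.CriticalPhenomena.PercolationContinuityZ3.Theorems

namespace HubOnly
namespace TypeTable

/-- A BUDGET-ROW SPECIFICATION: the row `(cut_t − cut_s)·1[COND] ≤ 0` with `COND` = `true` (`plain`), or `t ∉ B_s ∧ Q(k ∈ B_s, l ∈ B_s)`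
(`up = false`, `Q` antitone), or `s ∉ B_t ∧ Q(k ∈ B_t, l ∈ B_t)` (`up = true`, `Q` monotone). -/
structure RowSpec where
  /-- the relay whose cut mass is subtracted (larger marginal) -/
  s : ℕ
  /-- the relay whose cut mass is added (smaller marginal) -/
  t : ℕ
  /-- first other relay -/
  k : ℕ
  /-- second other relay -/
  l : ℕ
  /-- no block condition -/
  plain : Bool
  /-- condition on the block of `t` (up-set) instead of the block of `s` (down-set) -/
  up : Bool
  /-- the Boolean test on the two other relays' membership in the block -/
  Q : Bool → Bool → Bool

namespace RowSpec

variable (r : RowSpec)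

/-- The condition of the row at a shape. -/
def cond (σ : Shape) : Bool :=
  if r.plain then true
  else if r.up then !(σ.same r.t r.s) && r.Q (σ.same r.t r.k) (σ.same r.t r.l)
  else !(σ.same r.s r.t) && r.Q (σ.same r.s r.k) (σ.same r.s r.l)

/-- The value of the row functional at a shape: `(cut_t − cut_s)·1[COND]`. -/
def eval (σ : Shape) : ℤ := if r.cond σ then DType.ind (σ.cutf r.t) - DType.ind (σ.cutf r.s) else 0

/-- `b ≤ b'` for Booleans. -/
def ble (b b' : Bool) : Bool := !b || b'

/-- Side conditions: `(s,t,k,l)` is a permutation of `(1,2,3,4)` and `Q` is antitone (down rows) resp. monotone (up rows). -/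
def ok : Bool :=
  ([r.s, r.t, r.k, r.l].all fun x => decide (x ∈ [1, 2, 3, 4])) && decide ([r.s, r.t, r.k, r.l].Nodup) &&
  ([true, false].all fun b1 => [true, false].all fun b2 => [true, false].all fun b1' => [true, false].all fun b2' =>
    !(ble b1 b1' && ble b2 b2') ||
      (if r.up then ble (r.Q b1 b2) (r.Q b1' b2') else ble (r.Q b1' b2') (r.Q b1 b2)))

end RowSpec

/-- Specifications of the 22 `O`-free rows, aligned with `linFree`. -/
def linFreeSpec : List RowSpec :=
  [⟨1, 2, 3, 4, true, false, fun _ _ => true⟩, ⟨1, 3, 2, 4, true, false, fun _ _ => true⟩, ⟨1, 4, 2, 3, true, false, fun _ _ => true⟩,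
   -- calone x: 2,3,4 ∉ B₁ (down on B₁)
   ⟨1, 2, 3, 4, false, false, fun b1 b2 => !b1 && !b2⟩, ⟨1, 3, 2, 4, false, false, fun b1 b2 => !b1 && !b2⟩,
   ⟨1, 4, 2, 3, false, false, fun b1 b2 => !b1 && !b2⟩,
   -- cpair x y: 1 ∉ B_x, y ∈ B_x (up on B_x)
   ⟨1, 2, 3, 4, false, true, fun b1 _ => b1⟩, ⟨1, 2, 4, 3, false, true, fun b1 _ => b1⟩, ⟨1, 3, 4, 2, false, true, fun b1 _ => b1⟩,
   -- ctriple: 1 ∉ B₂, 3, 4 ∈ B₂ (up on B₂)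
   ⟨1, 2, 3, 4, false, true, fun b1 b2 => b1 && b2⟩,
   -- cnotfull x: x ∉ B₁, not both others in B₁ (down on B₁)
   ⟨1, 2, 3, 4, false, false, fun b1 b2 => !(b1 && b2)⟩, ⟨1, 3, 2, 4, false, false, fun b1 b2 => !(b1 && b2)⟩,
   ⟨1, 4, 2, 3, false, false, fun b1 b2 => !(b1 && b2)⟩,
   -- caloneY x y: x ∉ B₁, z ∉ B₁ (z the third; down on B₁)
   ⟨1, 2, 4, 3, false, false, fun b1 _ => !b1⟩, ⟨1, 2, 3, 4, false, false, fun b1 _ => !b1⟩,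
   ⟨1, 3, 4, 2, false, false, fun b1 _ => !b1⟩, ⟨1, 3, 2, 4, false, false, fun b1 _ => !b1⟩,
   ⟨1, 4, 3, 2, false, false, fun b1 _ => !b1⟩, ⟨1, 4, 2, 3, false, false, fun b1 _ => !b1⟩,
   -- cnotalone x: 1 ∉ B_x, another relay in B_x (up on B_x)
   ⟨1, 2, 3, 4, false, true, fun b1 b2 => b1 || b2⟩, ⟨1, 3, 2, 4, false, true, fun b1 b2 => b1 || b2⟩,
   ⟨1, 4, 2, 3, false, true, fun b1 b2 => b1 || b2⟩]

/-- Specifications of the nine `O`-rows of an ordered pair `(x, y)` (`w` the remaining relay of `{2,3,4}`), aligned with `linOrd`: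
`od, oalone, odnboth, oupany, oupboth, odn 1, odn w, oup 1, oup w`. -/
def linOrdSpecPair (x y w : ℕ) : List RowSpec :=
  [⟨x, y, 1, w, true, false, fun _ _ => true⟩, ⟨x, y, 1, w, false, false, fun b1 b2 => !b1 && !b2⟩,
   ⟨x, y, 1, w, false, false, fun b1 b2 => !(b1 && b2)⟩, ⟨x, y, 1, w, false, true, fun b1 b2 => b1 || b2⟩,
   ⟨x, y, 1, w, false, true, fun b1 b2 => b1 && b2⟩, ⟨x, y, 1, w, false, false, fun b1 _ => !b1⟩,
   ⟨x, y, w, 1, false, false, fun b1 _ => !b1⟩, ⟨x, y, 1, w, false, true, fun b1 _ => b1⟩,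
   ⟨x, y, w, 1, false, true, fun b1 _ => b1⟩]

/-- Specifications of the 27 `O`-rows, aligned with `linOrd`. -/
def linOrdSpec : List RowSpec := linOrdSpecPair 2 3 4 ++ linOrdSpecPair 2 4 3 ++ linOrdSpecPair 3 4 2

/-- The side conditions of the `O`-free specifications. -/
theorem linFreeSpec_ok : (linFreeSpec.all RowSpec.ok) = true := by decide

/-- The side conditions of the `O`-row specifications. -/
theorem linOrdSpec_ok : (linOrdSpec.all RowSpec.ok) = true := by decide

/-- The tables have the lengths of the row lists. -/
theorem spec_lengths : linFreeSpec.length = linFree.length ∧ linOrdSpec.length = linOrd.length := by decide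

/-- **Each `O`-free row functional at the canonical type of a valid shape equals its specification's value** (all `2¹⁰` shapes, one kernel
evaluation). -/
theorem linFree_eval_bool : ∀ s12 s13 s14 s23 s24 s34 c1 c2 c3 c4 : Bool,
    (⟨s12, s13, s14, s23, s24, s34, c1, c2, c3, c4⟩ : Shape).valid = true →
    ((List.zip linFree linFreeSpec).all fun p =>
      p.1 (⟨s12, s13, s14, s23, s24, s34, c1, c2, c3, c4⟩ : Shape).toType ==
        p.2.eval ⟨s12, s13, s14, s23, s24, s34, c1, c2, c3, c4⟩) = true := by
  decide +kernel

/-- **Each `O`-row functional at the canonical type of a valid shape equals its specification's value.** -/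
theorem linOrd_eval_bool : ∀ s12 s13 s14 s23 s24 s34 c1 c2 c3 c4 : Bool,
    (⟨s12, s13, s14, s23, s24, s34, c1, c2, c3, c4⟩ : Shape).valid = true →
    ((List.zip linOrd linOrdSpec).all fun p =>
      p.1 (⟨s12, s13, s14, s23, s24, s34, c1, c2, c3, c4⟩ : Shape).toType ==
        p.2.eval ⟨s12, s13, s14, s23, s24, s34, c1, c2, c3, c4⟩) = true := by
  decide +kernel

/-- Row `i` of `linFree` at the canonical type of a valid shape is the value of specification `i`. -/
theorem linFree_eval (σ : Shape) (hσ : σ.valid = true) (i : ℕ) (hi : i < linFree.length) :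
    (linFree[i]'hi) σ.toType = (linFreeSpec[i]'(spec_lengths.1 ▸ hi)).eval σ := by
  obtain ⟨s12, s13, s14, s23, s24, s34, c1, c2, c3, c4⟩ := σ
  have h := linFree_eval_bool s12 s13 s14 s23 s24 s34 c1 c2 c3 c4 hσ
  rw [List.all_eq_true] at h
  have hmem : (linFree[i]'hi, linFreeSpec[i]'(spec_lengths.1 ▸ hi)) ∈ List.zip linFree linFreeSpec :=
    List.mem_iff_getElem.2 ⟨i, by rw [List.length_zip, ← spec_lengths.1, min_self]; exact spec_lengths.1 ▸ hi,
      List.getElem_zip⟩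
  have := h _ hmem
  simpa using this

/-- Row `i` of `linOrd` at the canonical type of a valid shape is the value of specification `i`. -/
theorem linOrd_eval (σ : Shape) (hσ : σ.valid = true) (i : ℕ) (hi : i < linOrd.length) :
    (linOrd[i]'hi) σ.toType = (linOrdSpec[i]'(spec_lengths.2 ▸ hi)).eval σ := by
  obtain ⟨s12, s13, s14, s23, s24, s34, c1, c2, c3, c4⟩ := σ
  have h := linOrd_eval_bool s12 s13 s14 s23 s24 s34 c1 c2 c3 c4 hσ
  rw [List.all_eq_true] at h
  have hmem : (linOrd[i]'hi, linOrdSpec[i]'(spec_lengths.2 ▸ hi)) ∈ List.zip linOrd linOrdSpec :=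
    List.mem_iff_getElem.2 ⟨i, by rw [List.length_zip, ← spec_lengths.2, min_self]; exact spec_lengths.2 ▸ hi,
      List.getElem_zip⟩
  have := h _ hmem
  simpa using this

end TypeTable
end HubOnly
end Summit.CriticalPhenomena.PercolationContinuityZ3.Theorems
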